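import Summits.AnomalousDissipation.AnomalousDissipation.Theorems.DenseLoudDesignerForces.Negative.FalseWithoutConvection
import Literature.Analysis.FunctionSpaces.TorusClassicalNSGluing

/-!
# Negative knowledge for the crux `DenseLoudDesignerForces` (stmt-AnomalousDissipation-1143), VII:
# the DOPPLER CEILING — a mean flow decorrelates the force from every bounded fluctuation

Refuter (drefute, line `galilean-detuning-body-force-grid`) contribution to the witness anatomy: certified form of the
sweeping / inertial-pinning power ceiling N1 of `Cruxes/DenseLoudDesignerForces/NegativeNotesGridLoudness.md`.
If the steady force is a derivative ALONG A CONSTANT VECTOR `V` of a smooth solenoidal field, `F = (V·∇)ψ`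
(for the designer force `f_c` and any `V` with `k·V ≠ 0` on `S ∖ {0}` such a `ψ` is the explicit trigonometric
polynomial `dopplerField S V c`, coefficients `ĉ_k/(2πi k·V)`), then for EVERY `τ`-periodic classical orbit `u`
of NS_ν forced by `F` the exact period identity
`∫₀^τ∫⟪F,u⟫ = -∫₀^τ∫⟪u-V, ((u-V)·∇)ψ⟫ - ν∫₀^τ∫⟪u-V, Δψ⟫` holds (`doppler_period_identity`; momentum budget of
`Negative/MomentumBudget` tested against `ψ`, the drift terms being exact derivatives), whence the DOPPLER CEILING
(`meanDissipation_le_doppler`)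

  `⟨ν‖∇u‖²⟩ ≤ ‖Dψ‖_∞ · ⟨‖u - V‖²⟩ + (ν/2)(⟨‖u - V‖²⟩ + ∫‖Δψ‖²)`:

the injected power is paid ENTIRELY by the Reynolds stress of the fluctuation about `V` against the Doppler
antiderivative `ψ ~ F/(k·V)`; the drift energy `‖V‖²` buys no dissipation, and a fast transverse mean flow
(`|k·V| → ∞`) decorrelates the force from every fluctuation of bounded energy.  Designer form
(`meanDissipation_le_doppler_force`, `doppler_floor_of_loud`): for every witness `u` of `c ∈ LOUD_j(S,E,ε)` and every
constant `V` with `k·V ≠ 0` on `S ∖ {0}`,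
`ε ≤ Λ(c')⟨‖u-V‖²⟩ + (⟨‖u-V‖²⟩ + Λ₂(c')²)/(2(j+1))`, `c'_k = ĉ_k/(2πi k·V)`, `Λ = gradBound`, `Λ₂ = lapBound`.
For the drift class of the line `galilean-detuning-body-force-grid` (`u = V + w(t, x - tV)`, `V = √E_V n̂`,
`|k·n̂| ≥ κ‖k‖` on the stock, so `Λ(c') ≤ √3 ‖c‖₁/(κ√E_V)`, and `⟨‖u-V‖²⟩ = E_w`) this is the certified SWEEPING
CEILING `ε ≤ √3‖c‖₁E_w/(κ√E_V) + (E_w + Λ₂(c')²)/(2(j+1))`: loudness must come from an `O(E_w)` in-phase fluctuation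
stress, never from the sweep.  Supports stmt-AnomalousDissipation-1143 (witness anatomy; no verdict change — the
budgets `E_V, E_w, ε` and `U` are chosen after `κ`).
-/

noncomputable section

namespace Summit.AnomalousDissipation.AnomalousDissipation.Theorems.DenseLoudDesignerForces.Negative

open scoped BigOperators Topology ENNReal InnerProductSpace
open Filter Set MeasureTheory UnitAddTorus
open Literature.Analysis.FunctionSpaces Literature.Analysis.FluidPDE
open Summit.AnomalousDissipation.AnomalousDissipation.Theses.BaireTransfer

/-! ## §19 The Doppler ceiling (abstract form: `F = (V·∇)ψ`) -/

section Doppler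

variable {ν τ : ℝ} {F ψ : (UnitAddTorus (Fin 3)) → (EuclideanSpace ℝ (Fin 3))}
  {u : ℝ → (UnitAddTorus (Fin 3)) → (EuclideanSpace ℝ (Fin 3))} {p : ℝ → (UnitAddTorus (Fin 3)) → ℝ}
  {V : EuclideanSpace ℝ (Fin 3)}

/-- The Fréchet derivative of a constant field vanishes. -/
theorem fderiv_const_field (V : EuclideanSpace ℝ (Fin 3)) (x : UnitAddTorus (Fin 3)) :
    Torus.fderiv (fun _ : UnitAddTorus (Fin 3) => V) x = 0 := by
  show _root_.fderiv ℝ (fun _ : EuclideanSpace ℝ (Fin 3) => V) 0 = 0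
  simp

/-- A constant shift does not change the divergence. -/
theorem divergence_sub_const (a : (UnitAddTorus (Fin 3)) → (EuclideanSpace ℝ (Fin 3))) (V : EuclideanSpace ℝ (Fin 3))
    (x : UnitAddTorus (Fin 3)) : Torus.divergence (fun y => a y - V) x = Torus.divergence a x := by
  unfold Torus.divergence Torus.partialDeriv Torus.lineDeriv
  simp only [PiLp.sub_apply, deriv_sub_const]

/-- `∫⟪(V·∇)ψ, ψ⟫ = 0`: the pairing is half the integral of the derivative of `‖ψ‖²` along `V`. -/
theorem integral_inner_fderiv_const_self (hψ : Torus.IsSmooth ψ) (V : EuclideanSpace ℝ (Fin 3)) :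
    ∫ x, ⟪Torus.fderiv ψ x V, ψ x⟫_ℝ = 0 := by
  have h1 : ∀ x, ⟪Torus.fderiv ψ x V, ψ x⟫_ℝ = 2⁻¹ * Torus.lineDeriv (fun y => ‖ψ y‖ ^ 2) x V := by
    intro x
    rw [Torus.lineDeriv_eq_fderiv_apply (hψ.norm_sq.isContDiff (by simp)),
      Torus.fderiv_norm_sq_apply (hψ.isContDiff (by simp)), real_inner_comm]
    ring
  simp_rw [h1, integral_const_mul, Torus.integral_lineDeriv_eq_zero hψ.norm_sq V, mul_zero]

/-- `∫⟪V, Dψ[w]⟫ = 0` for a smooth divergence-free `w` (antisymmetry of the trilinear form with a constant field). -/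
theorem integral_inner_const_fderiv_apply {w : (UnitAddTorus (Fin 3)) → (EuclideanSpace ℝ (Fin 3))}
    (hw : Torus.IsSmooth w) (hdiv : Torus.IsDivFree w) (hψ : Torus.IsSmooth ψ) (V : EuclideanSpace ℝ (Fin 3)) :
    ∫ x, ⟪V, Torus.fderiv ψ x (w x)⟫_ℝ = 0 := by
  have h := Torus.integral_inner_convect_eq_neg hw hdiv (Torus.isSmooth_const V) hψ
  have h0 : (fun x => ⟪Torus.convect w (fun _ : UnitAddTorus (Fin 3) => V) x, ψ x⟫_ℝ) = fun _ => (0 : ℝ) := by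
    funext x
    rw [Torus.convect, fderiv_const_field]
    simp
  rw [h0, integral_zero] at h
  have : ∫ x, ⟪V, Torus.convect w ψ x⟫_ℝ = 0 := by linarith
  simpa [Torus.convect] using this

/-- `∫⟪V, Δψ⟫ = 0`. -/
theorem integral_inner_const_laplacian (hψ : Torus.IsSmooth ψ) (V : EuclideanSpace ℝ (Fin 3)) :
    ∫ x, ⟪V, Torus.laplacian ψ x⟫_ℝ = 0 := by
  rw [integral_inner hψ.laplacian.integrable, Torus.integral_laplacian_eq_zero_of_isSmooth hψ, inner_zero_right]

/-- DOPPLER SLICE IDENTITY.  If `F = (V·∇)ψ` then for every smooth divergence-free field `a`: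
`∫⟪a, (a·∇)ψ⟫ = ∫⟪F, a⟫ + ∫⟪a - V, ((a - V)·∇)ψ⟫` — the cross terms are exact derivatives. -/
theorem doppler_slice_identity {a : (UnitAddTorus (Fin 3)) → (EuclideanSpace ℝ (Fin 3))} (ha : Torus.IsSmooth a)
    (hdiv : Torus.IsDivFree a) (hψ : Torus.IsSmooth ψ) (hVψ : ∀ x, Torus.fderiv ψ x V = F x) :
    ∫ x, ⟪a x, Torus.convect a ψ x⟫_ℝ =
      (∫ x, ⟪F x, a x⟫_ℝ) + ∫ x, ⟪a x - V, Torus.fderiv ψ x (a x - V)⟫_ℝ := by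
  have hF : Torus.IsSmooth F := by
    have : F = fun x => Torus.fderiv ψ x V := funext fun x => (hVψ x).symm
    rw [this, show (fun x => Torus.fderiv ψ x V) = fun x => Torus.lineDeriv ψ x V from
      funext fun x => (Torus.lineDeriv_eq_fderiv_apply (hψ.isContDiff (by simp)) x V).symm]
    exact hψ.lineDeriv V
  have hw : Torus.IsSmooth (fun y => a y - V) := ha.sub (Torus.isSmooth_const V)
  have hwdiv : Torus.IsDivFree (fun y => a y - V) := fun x => by rw [divergence_sub_const]; exact hdiv x
  have hpt : ∀ x, ⟪a x, Torus.convect a ψ x⟫_ℝ =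
      ⟪F x, a x⟫_ℝ + ⟪a x - V, Torus.fderiv ψ x (a x - V)⟫_ℝ + ⟪V, Torus.fderiv ψ x (a x - V)⟫_ℝ := by
    intro x
    have hsplit : Torus.convect a ψ x = F x + Torus.fderiv ψ x (a x - V) := by
      rw [Torus.convect, ← hVψ x, ← map_add, add_sub_cancel]
    rw [hsplit, inner_add_right, real_inner_comm (F x) (a x)]
    have hs : ⟪a x, Torus.fderiv ψ x (a x - V)⟫_ℝ =
        ⟪a x - V, Torus.fderiv ψ x (a x - V)⟫_ℝ + ⟪V, Torus.fderiv ψ x (a x - V)⟫_ℝ := by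
      rw [← inner_add_left, sub_add_cancel]
    rw [hs, add_assoc]
  have i1 : Integrable (fun x => ⟪F x, a x⟫_ℝ) := (hF.inner ha).integrable
  have i2 : Integrable (fun x => ⟪a x - V, Torus.fderiv ψ x (a x - V)⟫_ℝ) := (hw.inner (hw.convect hψ)).integrable
  have i3 : Integrable (fun x => ⟪V, Torus.fderiv ψ x (a x - V)⟫_ℝ) :=
    ((Torus.isSmooth_const V).inner (hw.convect hψ)).integrable
  have i12 : Integrable (fun x => ⟪F x, a x⟫_ℝ + ⟪a x - V, Torus.fderiv ψ x (a x - V)⟫_ℝ) := i1.add i2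
  rw [show (fun x => ⟪a x, Torus.convect a ψ x⟫_ℝ) = fun x =>
      ⟪F x, a x⟫_ℝ + ⟪a x - V, Torus.fderiv ψ x (a x - V)⟫_ℝ + ⟪V, Torus.fderiv ψ x (a x - V)⟫_ℝ from funext hpt,
    integral_add i12 i3, integral_add i1 i2, integral_inner_const_fderiv_apply hw hwdiv hψ V, add_zero]

/-- DOPPLER PERIOD IDENTITY.  For a `τ`-periodic classical orbit forced by the steady field `F = (V·∇)ψ`
(`ψ` smooth, solenoidal; `V` any constant vector):
`∫₀^τ∫⟪F,u⟫ = -∫₀^τ∫⟪u-V, ((u-V)·∇)ψ⟫ - ν ∫₀^τ∫⟪u-V, Δψ⟫` — the injected work is the fluctuation's Reynolds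
stress against the Doppler antiderivative `ψ` (plus a viscous correction). -/
theorem doppler_period_identity (h : Torus.IsClassicalNSSolutionOn univ ν (fun _ => F) u p)
    (hψ : Torus.IsSmooth ψ) (hdivψ : Torus.IsDivFree ψ) (hVψ : ∀ x, Torus.fderiv ψ x V = F x)
    (hper : Function.Periodic u τ) :
    ∫ t in (0 : ℝ)..τ, ∫ x, ⟪F x, u t x⟫_ℝ =
      -(∫ t in (0 : ℝ)..τ, ∫ x, ⟪u t x - V, Torus.fderiv ψ x (u t x - V)⟫_ℝ) -
        ν * ∫ t in (0 : ℝ)..τ, ∫ x, ⟪u t x - V, Torus.laplacian ψ x⟫_ℝ := by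
  have hu := h.smooth_velocity
  have hF : Torus.IsSmooth F := isSmooth_of_solution h
  have hid := momentum_period_identity h hψ hdivψ hper
  -- the left side vanishes: `∫⟪F, ψ⟫ = ∫⟪(V·∇)ψ, ψ⟫ = 0`
  have hFψ : ∫ x, ⟪F x, ψ x⟫_ℝ = 0 := by
    have : (fun x => ⟪F x, ψ x⟫_ℝ) = fun x => ⟪Torus.fderiv ψ x V, ψ x⟫_ℝ := funext fun x => by rw [hVψ x]
    rw [this, integral_inner_fderiv_const_self hψ V]
  rw [hFψ, mul_zero] at hid
  -- slice identities
  have hconv : (fun t => ∫ x, ⟪u t x, Torus.convect (u t) ψ x⟫_ℝ) = fun t =>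
      (∫ x, ⟪F x, u t x⟫_ℝ) + ∫ x, ⟪u t x - V, Torus.fderiv ψ x (u t x - V)⟫_ℝ :=
    funext fun t => doppler_slice_identity (hu.isSmooth_slice (mem_univ t)) (h.divFree t (mem_univ t)) hψ hVψ
  have hlap : (fun t => ∫ x, ⟪u t x, Torus.laplacian ψ x⟫_ℝ) = fun t =>
      ∫ x, ⟪u t x - V, Torus.laplacian ψ x⟫_ℝ := by
    funext t
    have hut : Torus.IsSmooth (u t) := hu.isSmooth_slice (mem_univ t)
    have hw : Torus.IsSmooth (fun y => u t y - V) := hut.sub (Torus.isSmooth_const V)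
    have hpt : (fun x => ⟪u t x, Torus.laplacian ψ x⟫_ℝ) =
        fun x => ⟪u t x - V, Torus.laplacian ψ x⟫_ℝ + ⟪V, Torus.laplacian ψ x⟫_ℝ := by
      funext x; rw [← inner_add_left, sub_add_cancel]
    rw [hpt, integral_add (hw.inner hψ.laplacian).integrable ((Torus.isSmooth_const V).inner hψ.laplacian).integrable,
      integral_inner_const_laplacian hψ V, add_zero]
  rw [hconv, hlap] at hid
  -- split the time integral of the sum
  have hw_st : Torus.IsSmoothSpaceTimeOn univ (fun t x => u t x - V) :=
    hu.sub (Torus.isSmoothSpaceTimeOn_const (Torus.isSmooth_const V) univ)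
  have hψc : Torus.IsSmoothSpaceTimeOn univ (fun _ : ℝ => ψ) := Torus.isSmoothSpaceTimeOn_const hψ univ
  have hC1 : Continuous fun t => ∫ x, ⟪F x, u t x⟫_ℝ :=
    continuousOn_univ.1 (((Torus.isSmoothSpaceTimeOn_const hF univ).inner hu).continuousOn_integral convex_univ)
  have hC2 : Continuous fun t => ∫ x, ⟪u t x - V, Torus.fderiv ψ x (u t x - V)⟫_ℝ :=
    continuousOn_univ.1 ((hw_st.inner (hw_st.convect hψc uniqueDiffOn_univ)).continuousOn_integral convex_univ)
  rw [intervalIntegral.integral_add (hC1.intervalIntegrable _ _) (hC2.intervalIntegrable _ _)] at hid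
  linarith

/-- DOPPLER CEILING.  For a `τ`-periodic classical orbit (`τ > 0`, `ν ≥ 0`) forced by `F = (V·∇)ψ` with
`‖Dψ(x)w‖ ≤ M‖w‖`: `⟨ν‖∇u‖²⟩ ≤ M·⟨‖u-V‖²⟩ + (ν/2)(⟨‖u-V‖²⟩ + ∫‖Δψ‖²)` — the mean dissipation is bounded by the
FLUCTUATION energy about `V` times the strain of the Doppler antiderivative; the drift energy buys nothing. -/
theorem meanDissipation_le_doppler (h : Torus.IsClassicalNSSolutionOn univ ν (fun _ => F) u p) (hν : 0 ≤ ν)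
    (hψ : Torus.IsSmooth ψ) (hdivψ : Torus.IsDivFree ψ) (hVψ : ∀ x, Torus.fderiv ψ x V = F x) {M : ℝ}
    (hM : ∀ x w, ‖Torus.fderiv ψ x w‖ ≤ M * ‖w‖) (hper : Function.Periodic u τ) (hτ : 0 < τ) :
    meanDissipation ν u ≤ M * meanEnergy (fun t x => u t x - V) +
      ν / 2 * (meanEnergy (fun t x => u t x - V) + ∫ x, ‖Torus.laplacian ψ x‖ ^ 2) := by
  have hu := h.smooth_velocity
  have hid := doppler_period_identity h hψ hdivψ hVψ hper
  have hw_st : Torus.IsSmoothSpaceTimeOn univ (fun t x => u t x - V) :=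
    hu.sub (Torus.isSmoothSpaceTimeOn_const (Torus.isSmooth_const V) univ)
  have hwper : Function.Periodic (fun t x => u t x - V) τ := fun t => by simp only [hper t]
  -- the fluctuation energy profile
  have he_st : Torus.IsSmoothSpaceTimeOn univ (fun t x => ‖u t x - V‖ ^ 2) := by
    change ContDiffOn ℝ _ (fun z => ‖Torus.stLift (fun t x => u t x - V) z‖ ^ 2) _
    exact hw_st.norm_sq ℝ
  have he_cont : Continuous fun t => ∫ x, ‖u t x - V‖ ^ 2 :=
    continuousOn_univ.1 (he_st.continuousOn_integral convex_univ)
  set e : ℝ → ℝ := fun t => ∫ x, ‖u t x - V‖ ^ 2 with he_def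
  set L : ℝ := ∫ x, ‖Torus.laplacian ψ x‖ ^ 2 with hL_def
  have hL : 0 ≤ L := integral_nonneg fun _ => sq_nonneg _
  have hconv_pt : ∀ t, |∫ x, ⟪u t x - V, Torus.fderiv ψ x (u t x - V)⟫_ℝ| ≤ M * e t := by
    intro t
    have hwt : Torus.IsSmooth (fun x => u t x - V) := hw_st.isSmooth_slice (mem_univ t)
    have hb := norm_integral_le_of_norm_le (hwt.norm_sq.integrable.const_mul M)
      (ae_of_all _ fun x => show ‖⟪u t x - V, Torus.fderiv ψ x (u t x - V)⟫_ℝ‖ ≤ M * ‖u t x - V‖ ^ 2 from by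
        rw [Real.norm_eq_abs]
        calc |⟪u t x - V, Torus.fderiv ψ x (u t x - V)⟫_ℝ| ≤ ‖u t x - V‖ * ‖Torus.fderiv ψ x (u t x - V)‖ :=
              abs_real_inner_le_norm _ _
          _ ≤ ‖u t x - V‖ * (M * ‖u t x - V‖) := by
              gcongr
              exact hM x (u t x - V)
          _ = M * ‖u t x - V‖ ^ 2 := by ring)
    rw [Real.norm_eq_abs, integral_const_mul] at hb
    exact hb
  have hlap_pt : ∀ t, |∫ x, ⟪u t x - V, Torus.laplacian ψ x⟫_ℝ| ≤ (e t + L) / 2 := by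
    intro t
    have hwt : Torus.IsSmooth (fun x => u t x - V) := hw_st.isSmooth_slice (mem_univ t)
    have hint : Integrable (fun x => (‖u t x - V‖ ^ 2 + ‖Torus.laplacian ψ x‖ ^ 2) / 2) :=
      (hwt.norm_sq.integrable.add hψ.laplacian.norm_sq.integrable).div_const 2
    have hb := norm_integral_le_of_norm_le hint (ae_of_all _ fun x =>
      show ‖⟪u t x - V, Torus.laplacian ψ x⟫_ℝ‖ ≤ (‖u t x - V‖ ^ 2 + ‖Torus.laplacian ψ x‖ ^ 2) / 2 from by
        rw [Real.norm_eq_abs]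
        calc |⟪u t x - V, Torus.laplacian ψ x⟫_ℝ| ≤ ‖u t x - V‖ * ‖Torus.laplacian ψ x‖ := abs_real_inner_le_norm _ _
          _ ≤ (‖u t x - V‖ ^ 2 + ‖Torus.laplacian ψ x‖ ^ 2) / 2 := by
              nlinarith [sq_nonneg (‖u t x - V‖ - ‖Torus.laplacian ψ x‖)])
    rw [Real.norm_eq_abs, integral_div, integral_add hwt.norm_sq.integrable hψ.laplacian.norm_sq.integrable] at hb
    exact hb
  have hconv_time : |∫ t in (0 : ℝ)..τ, ∫ x, ⟪u t x - V, Torus.fderiv ψ x (u t x - V)⟫_ℝ| ≤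
      M * ∫ t in (0 : ℝ)..τ, e t := by
    have := intervalIntegral.norm_integral_le_of_norm_le hτ.le
      (ae_of_all _ fun t _ => (Real.norm_eq_abs _).trans_le (hconv_pt t))
      ((he_cont.intervalIntegrable (μ := volume) 0 τ).const_mul M)
    rw [Real.norm_eq_abs, intervalIntegral.integral_const_mul] at this
    exact this
  have hlap_time : |∫ t in (0 : ℝ)..τ, ∫ x, ⟪u t x - V, Torus.laplacian ψ x⟫_ℝ| ≤
      ((∫ t in (0 : ℝ)..τ, e t) + τ * L) / 2 := by
    have := intervalIntegral.norm_integral_le_of_norm_le hτ.le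
      (ae_of_all _ fun t _ => (Real.norm_eq_abs _).trans_le (hlap_pt t))
      (((he_cont.add continuous_const).div_const 2).intervalIntegrable (μ := volume) 0 τ)
    rw [Real.norm_eq_abs] at this
    refine this.trans_eq ?_
    rw [intervalIntegral.integral_div, intervalIntegral.integral_add (he_cont.intervalIntegrable _ _)
      intervalIntegrable_const, intervalIntegral.integral_const, sub_zero, smul_eq_mul]
  -- assemble
  have hE : meanEnergy (fun t x => u t x - V) = τ⁻¹ * ∫ t in (0 : ℝ)..τ, e t := meanEnergy_eq_period_mean hwper hτ
  have hD : meanDissipation ν u = τ⁻¹ * ∫ t in (0 : ℝ)..τ, ∫ x, ⟪F x, u t x⟫_ℝ :=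
    meanDissipation_eq_meanPower h hper hτ
  have key : ∫ t in (0 : ℝ)..τ, ∫ x, ⟪F x, u t x⟫_ℝ ≤
      M * (∫ t in (0 : ℝ)..τ, e t) + ν * (((∫ t in (0 : ℝ)..τ, e t) + τ * L) / 2) := by
    rw [hid]
    calc -(∫ t in (0 : ℝ)..τ, ∫ x, ⟪u t x - V, Torus.fderiv ψ x (u t x - V)⟫_ℝ) -
          ν * ∫ t in (0 : ℝ)..τ, ∫ x, ⟪u t x - V, Torus.laplacian ψ x⟫_ℝ
        ≤ |∫ t in (0 : ℝ)..τ, ∫ x, ⟪u t x - V, Torus.fderiv ψ x (u t x - V)⟫_ℝ| +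
          ν * |∫ t in (0 : ℝ)..τ, ∫ x, ⟪u t x - V, Torus.laplacian ψ x⟫_ℝ| := by
            have h1 := neg_abs_le (∫ t in (0 : ℝ)..τ, ∫ x, ⟪u t x - V, Torus.fderiv ψ x (u t x - V)⟫_ℝ)
            have h2 := neg_abs_le (∫ t in (0 : ℝ)..τ, ∫ x, ⟪u t x - V, Torus.laplacian ψ x⟫_ℝ)
            nlinarith [h1, h2, hν]
      _ ≤ M * (∫ t in (0 : ℝ)..τ, e t) + ν * (((∫ t in (0 : ℝ)..τ, e t) + τ * L) / 2) := by
            gcongr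
  rw [hD, hE]
  have hτinv : 0 < τ⁻¹ := inv_pos.2 hτ
  have := mul_le_mul_of_nonneg_left key hτinv.le
  refine this.trans_eq ?_
  have hI : τ⁻¹ * (τ * L) = L := by rw [← mul_assoc, inv_mul_cancel₀ hτ.ne', one_mul]
  calc τ⁻¹ * (M * (∫ t in (0 : ℝ)..τ, e t) + ν * (((∫ t in (0 : ℝ)..τ, e t) + τ * L) / 2))
      = M * (τ⁻¹ * ∫ t in (0 : ℝ)..τ, e t) + ν / 2 * (τ⁻¹ * (∫ t in (0 : ℝ)..τ, e t) + τ⁻¹ * (τ * L)) := by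
        ring
    _ = M * (τ⁻¹ * ∫ t in (0 : ℝ)..τ, e t) + ν / 2 * (τ⁻¹ * (∫ t in (0 : ℝ)..τ, e t) + L) := by rw [hI]

end Doppler

/-! ## §19b The Doppler antiderivative of a designer force along a non-resonant drift

For the designer force `f_c = realTrigPoly S (P_k ĉ_k)` and a constant vector `V` with `k·V ≠ 0` for every
`k ∈ S ∖ {0}`, the field `ψ = dopplerField S V c := f_{c'}`, `c'_k = ĉ_k/(2πi k·V)` (again a designer force: smooth,
solenoidal, mean-free) satisfies `(V·∇)ψ = f_c`; its strain and Laplacian are controlled by `gradBound S c'`,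
`lapBound S c'` (`Negative/WindowBounds`, `Negative/FalseWithoutConvection`).  Hence the Doppler ceiling for the
crux's own witnesses: `⟨ν‖∇u‖²⟩ ≤ Λ(c')⟨‖u-V‖²⟩ + (ν/2)(⟨‖u-V‖²⟩ + Λ₂(c')²)` for EVERY constant `V` off the
resonant planes of the stock (`meanDissipation_le_doppler_force`). -/

section Designer

variable {S : Finset (Fin 3 → ℤ)}

/-- The Doppler frequency `k·V` of the mode `k` under the drift `V`. -/
def dopplerFreq (V : EuclideanSpace ℝ (Fin 3)) (k : Fin 3 → ℤ) : ℝ := ∑ i, ((k i : ℤ) : ℝ) * V i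

/-- Coefficients of the Doppler antiderivative: `c'_k = (2πi k·V)⁻¹ ĉ_k` (junk `0⁻¹ = 0` on resonant modes). -/
def dopplerCoeff (S : Finset (Fin 3 → ℤ)) (V : EuclideanSpace ℝ (Fin 3)) (c : ↥S → (EuclideanSpace ℂ (Fin 3))) :
    ↥S → (EuclideanSpace ℂ (Fin 3)) :=
  fun k => (2 * Real.pi * Complex.I * (dopplerFreq V (k : Fin 3 → ℤ) : ℂ))⁻¹ • c k

/-- The Doppler antiderivative `ψ_{c,V} = f_{c'}` of the designer force `f_c` along `V`. -/
def dopplerField (S : Finset (Fin 3 → ℤ)) (V : EuclideanSpace ℝ (Fin 3)) (c : ↥S → (EuclideanSpace ℂ (Fin 3))) :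
    (UnitAddTorus (Fin 3)) → (EuclideanSpace ℝ (Fin 3)) :=
  force S (dopplerCoeff S V c)

/-- The Leray multiplier is `ℂ`-homogeneous. -/
theorem lerayCoeff_smul (k : Fin 3 → ℤ) (a : ℂ) (v : EuclideanSpace ℂ (Fin 3)) :
    Torus.lerayCoeff k (a • v) = a • Torus.lerayCoeff k v := by
  by_cases hk : k = 0
  · subst hk; simp
  · rw [Torus.lerayCoeff_of_ne_zero hk, Torus.lerayCoeff_of_ne_zero hk, Torus.leraySym_smul]

/-- DIRECTIONAL DERIVATIVE OF A DESIGNER FORCE: `D f_{c'}(x)[V] = realTrigPoly S (2πi(k·V) P_k ĉ'_k)(x)` — the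
Doppler multiplier `2πi k·V` on each mode. -/
theorem fderiv_force_apply_const (c' : ↥S → (EuclideanSpace ℂ (Fin 3))) (x : UnitAddTorus (Fin 3))
    (V : EuclideanSpace ℝ (Fin 3)) :
    Torus.fderiv (force S c') x V = Torus.realTrigPoly S
      (fun k => (2 * Real.pi * Complex.I * (dopplerFreq V k : ℂ)) • Torus.lerayCoeff k (Torus.coeffExt S c' k)) x := by
  rw [Torus.fderiv_apply_eq_sum_partialDeriv ((isSmooth_force S c').isContDiff (by simp)) x V]
  unfold force
  simp_rw [Torus.partialDeriv_realTrigPoly, Torus.realTrigPoly_apply, Torus.trigPoly_apply]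
  -- move the real scalars `V i` inside the (ℝ-linear) real part and collect the modes
  have h1 : ∀ i : Fin 3, ∀ z : EuclideanSpace ℂ (Fin 3),
      V i • EuclideanSpace.realPart z = EuclideanSpace.realPart ((V i : ℂ) • z) := by
    intro i z
    rw [Complex.coe_smul, map_smul]
  simp_rw [h1, ← map_sum]
  congr 1
  simp_rw [Finset.smul_sum]
  rw [Finset.sum_comm]
  refine Finset.sum_congr rfl fun k _ => ?_
  have hσ : (2 * Real.pi * Complex.I * (dopplerFreq V k : ℂ)) • Torus.lerayCoeff k (Torus.coeffExt S c' k) =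
      ∑ i : Fin 3, ((V i : ℂ) * (2 * Real.pi * Complex.I * ((k i : ℤ) : ℂ))) •
        Torus.lerayCoeff k (Torus.coeffExt S c' k) := by
    rw [← Finset.sum_smul]
    congr 1
    unfold dopplerFreq
    push_cast
    rw [Finset.mul_sum]
    refine Finset.sum_congr rfl fun i _ => ?_
    ring
  rw [hσ, Finset.smul_sum]
  refine Finset.sum_congr rfl fun i _ => ?_
  rw [smul_smul, smul_smul, smul_smul]
  congr 1
  ring

/-- `(V·∇)ψ_{c,V} = f_c` when `V` is off every resonant plane of the stock: `k·V ≠ 0` for `k ∈ S ∖ {0}`. -/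
theorem fderiv_dopplerField {V : EuclideanSpace ℝ (Fin 3)} (hV : ∀ k ∈ S, k ≠ 0 → dopplerFreq V k ≠ 0) (c : ↥S → (EuclideanSpace ℂ (Fin 3)))
    (x : UnitAddTorus (Fin 3)) : Torus.fderiv (dopplerField S V c) x V = force S c x := by
  unfold dopplerField
  rw [fderiv_force_apply_const]
  unfold force
  refine congrFun (Torus.realTrigPoly_congr fun k hk => ?_) x
  rw [Torus.coeffExt_of_mem _ hk, Torus.coeffExt_of_mem _ hk, dopplerCoeff, lerayCoeff_smul, smul_smul]
  by_cases hk0 : k = 0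
  · subst hk0; simp
  · have hσ : (2 * Real.pi * Complex.I * (dopplerFreq V k : ℂ)) ≠ 0 := by
      have h1 : (dopplerFreq V k : ℂ) ≠ 0 := by exact_mod_cast hV k hk hk0
      have h2 : (2 * Real.pi * Complex.I : ℂ) ≠ 0 := by
        simp [Real.pi_ne_zero, Complex.I_ne_zero]
      exact mul_ne_zero h2 h1
    rw [mul_inv_cancel₀ hσ, one_smul]

variable {ν τ E ε : ℝ} {V : EuclideanSpace ℝ (Fin 3)} {c : ↥S → (EuclideanSpace ℂ (Fin 3))}
  {u : ℝ → (UnitAddTorus (Fin 3)) → (EuclideanSpace ℝ (Fin 3))} {p : ℝ → (UnitAddTorus (Fin 3)) → ℝ}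

/-- DOPPLER CEILING FOR DESIGNER FORCES.  For every `τ`-periodic classical orbit forced by `f_c` (`ν ≥ 0`) and
every constant vector `V` off the resonant planes of the stock (`k·V ≠ 0` on `S ∖ {0}`):
`⟨ν‖∇u‖²⟩ ≤ Λ(c')·⟨‖u-V‖²⟩ + (ν/2)(⟨‖u-V‖²⟩ + Λ₂(c')²)`, `c'_k = ĉ_k/(2πi k·V)`, `Λ = gradBound`, `Λ₂ = lapBound`.
Reading: the power injected by `f_c` into an orbit with mean flow `V` is carried by the FLUCTUATION Reynolds stress
against `f_c/(k·V)`; uniformly swept stock modes (`|k·V| ≥ κ√E_V‖k‖`) inject at most `O(‖c‖ E_w/(κ√E_V))`. -/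
theorem meanDissipation_le_doppler_force (hV : ∀ k ∈ S, k ≠ 0 → dopplerFreq V k ≠ 0)
    (h : Torus.IsClassicalNSSolutionOn univ ν (fun _ => force S c) u p) (hν : 0 ≤ ν)
    (hper : Function.Periodic u τ) (hτ : 0 < τ) :
    meanDissipation ν u ≤ gradBound S (dopplerCoeff S V c) * meanEnergy (fun t x => u t x - V) +
      ν / 2 * (meanEnergy (fun t x => u t x - V) + lapBound S (dopplerCoeff S V c) ^ 2) := by
  have hψ : Torus.IsSmooth (dopplerField S V c) := isSmooth_force S _
  have hdiv : Torus.IsDivFree (dopplerField S V c) := isDivFree_force S _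
  have hM : ∀ x w, ‖Torus.fderiv (dopplerField S V c) x w‖ ≤ gradBound S (dopplerCoeff S V c) * ‖w‖ :=
    fun x w => norm_fderiv_force_le S (dopplerCoeff S V c) x w
  have h1 := meanDissipation_le_doppler h hν hψ hdiv (fderiv_dopplerField hV c) hM hper hτ
  have hL : ∫ x, ‖Torus.laplacian (dopplerField S V c) x‖ ^ 2 ≤ lapBound S (dopplerCoeff S V c) ^ 2 :=
    integral_norm_sq_laplacian_force_le S (dopplerCoeff S V c)
  have hν2 : 0 ≤ ν / 2 := by linarith
  have h2 := mul_le_mul_of_nonneg_left (add_le_add_left hL (meanEnergy (fun t x => u t x - V))) hν2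
  linarith

/-- On the loud set: every witness of `c ∈ LOUD_j(S,E,ε)` obeys, for every non-resonant `V`,
`ε ≤ Λ(c')⟨‖u-V‖²⟩ + (⟨‖u-V‖²⟩ + Λ₂(c')²)/(2(j+1))` — loudness needs FLUCTUATION energy `⟨‖u-V‖²⟩ ≳ ε/Λ(c')` about
every candidate mean flow `V`; a witness cannot be a small fluctuation riding on a fast transverse drift. -/
theorem doppler_floor_of_loud (hV : ∀ k ∈ S, k ≠ 0 → dopplerFreq V k ≠ 0)
    (h : Torus.IsClassicalNSSolutionOn univ ν (fun _ => force S c) u p) (hν : 0 < ν) {j : ℕ}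
    (hνj : ν < 1 / ((j : ℝ) + 1)) (hper : Function.Periodic u τ) (hτ : 0 < τ) (hεu : ε ≤ meanDissipation ν u) :
    ε ≤ gradBound S (dopplerCoeff S V c) * meanEnergy (fun t x => u t x - V) +
      (meanEnergy (fun t x => u t x - V) + lapBound S (dopplerCoeff S V c) ^ 2) / (2 * ((j : ℝ) + 1)) := by
  have h1 := meanDissipation_le_doppler_force hV h hν.le hper hτ
  have hwper : Function.Periodic (fun t x => u t x - V) τ := fun t => by simp only [hper t]
  have hE : 0 ≤ meanEnergy (fun t x => u t x - V) := meanEnergy_nonneg' hwper hτ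
  have hW : 0 ≤ meanEnergy (fun t x => u t x - V) + lapBound S (dopplerCoeff S V c) ^ 2 := by positivity
  have hj : (0 : ℝ) < (j : ℝ) + 1 := by positivity
  have hνle : ν / 2 * (meanEnergy (fun t x => u t x - V) + lapBound S (dopplerCoeff S V c) ^ 2) ≤
      (meanEnergy (fun t x => u t x - V) + lapBound S (dopplerCoeff S V c) ^ 2) / (2 * ((j : ℝ) + 1)) := by
    rw [le_div_iff₀ (by positivity)]
    have : ν * ((j : ℝ) + 1) ≤ 1 := by
      rw [lt_div_iff₀ hj] at hνj
      linarith
    nlinarith [hW, this]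
  linarith

end Designer

end Summit.AnomalousDissipation.AnomalousDissipation.Theorems.DenseLoudDesignerForces.Negative

end
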